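import Literature.MathematicalPhysics.QuantumChemistry.ThreeIndexRelaxationBound
import Literature.MathematicalPhysics.QuantumChemistry.OnePositivityFromTwoPositivity
import HarnessLib

/-!
# Traces of the positivity blocks on the feasible set: the a-priori primal bounds of the
# a-posteriori (Jansson–Chaykin–Keil) semidefinite error bound for the `T1`, `T2`, `T2′` blocks

Topic `Literature/MathematicalPhysics/QuantumChemistry`; continues `OnePositivityFromTwoPositivity.lean`
(there: `IsDQGFeasible.trace_two / trace_qMap / trace_gMap`, the traces `N(N−1)`, `(r−N)(r−N−1)`,
`N(r−N+1)` of the `D`, `Q`, `G` blocks on the DQG-feasible set, "the factors `n_d`, `n_q`, and `n_g`,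
which normalize the D-, the Q- and the G-matrices to unity", Mazziotti 2007 §II.E.3 p.34) with the
THREE-INDEX blocks of `ThreeIndexRelaxationBound.lean` (`t1Map`, `t2Map`, `t2PrimeMap`: the `T1`, `T2`,
`T2′` functionals of Nakata et al. (2008) §II.A–B on an abstract pair `(γ, Γ)`).

WHY (the a-posteriori bound). A rigorous lower bound of a semidefinite relaxation computed from an
APPROXIMATE (floating-point, possibly non-converged) dual vector `ỹ` charges, for every positive
semidefinite block `j` whose dual slack `D_j = C_j − Σ_i ỹ_i A_ij` has a certified smallest-eigenvalue
bound `d_j < 0`, the penalty `d_j · x̄_j` with `x̄_j` an A-PRIORI bound of the primal block valid on the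
WHOLE feasible set — Jansson's primal boundedness qualification "PBQ (ii): … there is a simple bound
`x̄ ∈ K` such that for every `ε > 0` there exists a primal feasible solution `x(ε) ≤ x̄` …" and Theorem 4.1
(a) `f̂_p ≥ ⟨ỹ, b⟩ + ⟨d⁻, x̄⟩` (Jansson 2007 §4 p.8; SDP form Cor. 6.1 p.13; block form Cor. 7.1 p.14); in
the TRACE form of the tree (`Literature.Computation.Certificates.JanssonChaykinKeil.theorem_3_2_traceBound`,
`….lmiForm_bound`: penalty `Σ_j |min(0, d_j)| τ_j` with `tr X_j ≤ τ_j`). For the `N`-representability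
programme the feasible set FIXES the trace of every positivity block (Lange 2020 p.22: "since the trace
of every primal feasible point `X` is equal to 1 …, this immediately yields an upper bound for any primal
optimal point"; Jansson 2007 §9 p.16: "the constraints `diag(X) = e, X ⪰ 0` imply PBQ with finite upper
bounds `λ_max(X) ≤ x̄ = n`"), so the admissible `τ_j` are EXACT CONSTANTS, polynomials in the particle
number `N` and the number `r = |ι|` of spin orbitals, determined by the linear rows alone (trace row,
contraction row, antisymmetry) — NOT quantities to be read off a floating-point primal iterate. This file
PROVES them for the three-index blocks (the two-index ones are cited above):

* `IsDQGFeasible.sum_t2Map_diag` — the `k`-summed diagonal of `T2` at fixed `(i, j)` (an identity of the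
  printed entry formula, Nakata 2008 §II.A; no feasibility needed);
* **`IsDQGFeasible.trace_t2Map`** — `tr T2 = Σ_{(ijk) ∈ ι³} T2_{(ijk),(ijk)} = N · (r(r−1) − (r−2)(N−1))`
  on the DQG-feasible set (full index set `ι³`, both orders of the creator pair counted, repeated-index
  rows included — they are null);
* **`IsDQGFeasible.trace_t2PrimeMap`** — `tr T2′ = tr T2 + tr γ = N · (r(r−1) − (r−2)(N−1)) + N`
  (the corner block of `T2′ = (T2 X; X† γ)` is the 1-matrix, Nakata 2008 §II.B);
* **`IsDQGFeasible.trace_t1Map`** — `tr T1 = N(N−1)(N−2) + (r−N)(r−N−1)(r−N−2)` on the DQG-feasible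
  set: on a state `T1 = ³D + ³Qᵀ` (`t1Map_rdm`) and the two summands are the second-quantized
  normalisations of the 3-particle and 3-hole matrices, "`N!/(p!(N−p)!)`" and "`(r−N)!/(p!(r−N−p)!)`" at
  `p = 3` without the `1/p!` (Mazziotti 2007, Ch. 8, §II.A eq. (8) p.168 and §III.B eq. (18) p.172, the
  tree's `oneRDM`/`twoRDM` carry no `1/p!`); here it is proved for every ABSTRACT feasible pair from the
  rows alone;
* `re_sum_diag_submatrix_le_of_posSemidef` — THE SUB-BLOCK RULE: for a positive semidefinite matrix the
  (real) trace of any principal sub-block selected by an INJECTIVE member map is at most the (real) trace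
  of the whole matrix (diagonal entries are non-negative). Consequence for certificates: a block of a
  generator that is a member-list sub-block of `D`, `Q`, `G`, `T1`, `T2`, `T2′` (spin classes, point-group
  irreducible blocks, the principal part of a spin-flip quotient) is charged with the constant of its
  PARENT matrix — an irreducible-representation block has no trace constant of its own (the rows do not fix
  it), only this bound; the exact finer constants of the `S_z` spin classes, which the sector rows do fix,
  are a separate statement over `IsDQGFeasibleSector`;
* `IsDQGT1T2PrimeFeasible.re_sum_diag_submatrix_t1Map_le` / `…_t2Map_le` / `…_t2PrimeMap_le` and
  `IsDQGFeasible.re_sum_diag_submatrix_two_le` / `…_qMap_le` / `…_gMap_le` — the admissible `τ` for ANY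
  injective member list into each of the six positivity blocks, on the feasible set of the programme that
  carries that block (`PQGT1T2′` for the three-index ones, DQG for the two-index ones), as real numbers.

Magnitudes (arithmetic of the proved formulas, for orientation of certificate producers; not decls): at
`(N, r) = (30, 40)` ([2Fe–2S] (30e, 20o)) `tr T2′ = 13 770`, `tr T1 = 25 080`; at `(54, 108)`
(FeMoco-54) `tr T2′ = 320 706`, `tr T1 = 297 648`; a slack eigenvalue deficit `d_j = −10⁻⁶` on one full
`T2′` block at `r = 40` therefore costs `1.4·10⁻² E_h` — the certified end must drive `|d_j|` below
`≈ 7·10⁻⁸` (`r = 40`) resp. `≈ 3·10⁻⁹` (`r = 108`) for a loss under `10⁻³ E_h` per block.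

WHAT THIS FILE IS NOT: not a statement about any particular generator's block layout (member lists,
ordered versus unordered pairs/triples — an ordered-triple family `i<j<k` carries `1/6`, an ordered-pair
family `i<j` carries `1/2` of the corresponding full-index constant, by the symmetry of the diagonal; that
bookkeeping is the reader's); not the spin-class (`S_z`-block) constants (sector rows; separate file); not
a floating-point statement. Everything below is PROVED (0 sorry); no new definitions.

References (pages opened 2026-08-26 by the typer): C. Jansson, *Guaranteed accuracy for conic programming
problems in vector lattices*, arXiv:0707.4366 (2007), §4 PBQ + Thm 4.1 p.8, §6 Cor. 6.1 p.13, §9 p.16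
[Jansson2007]; C. Jansson, D. Chaykin, C. Keil, SIAM J. Numer. Anal. 46 (2007/08) 180, Thm 3.2 (through
the tree decls) [JanssonChaykinKeil2008]; M. Lange, NOLTA IEICE 11 (2020) 327, p.22 [Lange2020];
M. Nakata, B. J. Braams, K. Fujisawa, M. Fukuda, J. K. Percus, M. Yamashita, Z. Zhao, J. Chem. Phys. 128
(2008) 164113, §II.A–B (PDF p.5) [NakataEtAl2008]; D. A. Mazziotti, in Reduced-Density-Matrix Mechanics,
Adv. Chem. Phys. 134 (2007), Ch. 3 §II.E.3 p.34 [Mazziotti2007RDMChapter] and Ch. 8 §II.A eq. (8)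
p.167–168, §III.B eq. (18) p.172 [Mazziotti2007CSEChapter].
-/

noncomputable section

namespace Literature.MathematicalPhysics.QuantumChemistry

open Matrix Finset Literature.MathematicalPhysics.QuantumLattice
open scoped ComplexOrder

/-! ### The sub-block rule -/

section SubBlock

variable {m n : Type*} [Fintype m] [Fintype n]

/-- **THE SUB-BLOCK RULE.** For a positive semidefinite complex matrix `M` and an INJECTIVE member map
`f : m → n`, the real trace of the principal sub-block `M[f, f]` is at most the real trace of `M` (the
diagonal of a positive semidefinite matrix is entrywise non-negative, and `f` selects each diagonal entry
at most once). In the a-posteriori bound this is the rule "a member-list block is charged with the trace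
constant of its parent positivity matrix" — the analogue of "the constraints `diag(X) = e, X ⪰ 0` imply
PBQ with finite upper bounds" for sub-blocks. [cite: Jansson2007, §4 PBQ (ii), p.8; §9, p.16] -/
theorem re_sum_diag_submatrix_le_of_posSemidef {M : Matrix n n ℂ} (hM : M.PosSemidef) {f : m → n}
    (hf : Function.Injective f) :
    ∑ i, (M (f i) (f i)).re ≤ ∑ j, (M j j).re := by
  classical
  have h1 : ∑ i, (M (f i) (f i)).re = ∑ j ∈ Finset.univ.image f, (M j j).re := by
    rw [Finset.sum_image fun x _ y _ hxy => hf hxy]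
  rw [h1]
  exact Finset.sum_le_sum_of_subset_of_nonneg (Finset.subset_univ _)
    fun j _ _ => (Complex.nonneg_iff.mp (hM.diag_nonneg (i := j))).1

/-- The sub-block rule in `submatrix` notation: `Re tr (M.submatrix f f) ≤ Re tr M` for `M ⪰ 0` and
injective `f`. [cite: Jansson2007, §4 PBQ (ii), p.8; §9, p.16] -/
theorem re_trace_submatrix_le_of_posSemidef {M : Matrix n n ℂ} (hM : M.PosSemidef) {f : m → n}
    (hf : Function.Injective f) :
    ((M.submatrix f f).trace).re ≤ (M.trace).re := by
  simp only [Matrix.trace, Matrix.diag, Matrix.submatrix_apply, Complex.re_sum]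
  exact re_sum_diag_submatrix_le_of_posSemidef hM hf

end SubBlock

/-! ### The three-index trace constants on the DQG-feasible set -/

section Abstract

variable {ι : Type*} [LinearOrder ι] [Fintype ι] {N : ℕ} {γ : Matrix ι ι ℂ}
  {Γ : Matrix (ι × ι) (ι × ι) ℂ}

omit [Fintype ι] in
/-- The `k`-summed diagonal of the `T2` functional at a fixed creator pair `(i, j)` (an identity of the
printed entry formula `T2^{ijk}_{lmn}` of Nakata et al. (2008) §II.A at `(l, m, n) = (i, j, k)`; the
`i = j` rows contribute `r · Γ^{ii}_{ii}`, which vanishes on the feasible set):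
`Σ_k T2_{(ijk),(ijk)} = r Γ^{ij}_{ij} − Σ_k Γ^{kj}_{kj} − Σ_k Γ^{ki}_{ki} + Σ_k γ^k_k
  + [i = j] (2 Σ_k Γ^{ki}_{ki} − Σ_k γ^k_k)`. [cite: NakataEtAl2008, §II.A] -/
theorem sum_t2Map_diag [Fintype ι] (γ : Matrix ι ι ℂ) (Γ : Matrix (ι × ι) (ι × ι) ℂ) (i j : ι) :
    ∑ k, t2Map γ Γ (i, j, k) (i, j, k) =
      (Fintype.card ι : ℂ) * Γ (i, j) (i, j) - ∑ k, Γ (k, j) (k, j) - ∑ k, Γ (k, i) (k, i) +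
        ∑ k, γ k k + (if i = j then 2 * ∑ k, Γ (k, i) (k, i) - ∑ k, γ k k else 0) := by
  by_cases hij : i = j
  · subst hij
    simp only [t2Map_apply, reduceIte, one_mul, Finset.sum_add_distrib, Finset.sum_sub_distrib,
      Finset.sum_const, Finset.card_univ, nsmul_eq_mul]
    ring
  · simp only [t2Map_apply, reduceIte, if_neg hij, if_neg (Ne.symm hij), one_mul, zero_mul,
      Finset.sum_add_distrib, Finset.sum_sub_distrib, Finset.sum_const, Finset.card_univ,
      nsmul_eq_mul]
    ring

/-- **`tr T2 = N (r(r−1) − (r−2)(N−1))`** on the DQG-feasible set (`r = |ι|` spin orbitals, `N`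
electrons; full index set `ι × ι × ι`): the a-priori trace constant of the `T2` block for the
a-posteriori bound. Uses only `Tr γ = N` and the contraction row (through `trace_two`). The functional is
that of Nakata et al. (2008) §II.A; the constant is computed here. [cite: NakataEtAl2008, §II.A] -/
theorem IsDQGFeasible.trace_t2Map (h : IsDQGFeasible N γ Γ) :
    ∑ I : ι × ι × ι, t2Map γ Γ I I =
      (N : ℂ) * ((Fintype.card ι : ℂ) * ((Fintype.card ι : ℂ) - 1) -
        ((Fintype.card ι : ℂ) - 2) * ((N : ℂ) - 1)) := by
  have hA : ∑ i, ∑ j, Γ (i, j) (i, j) = (N : ℂ) * ((N : ℂ) - 1) := by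
    have h2 := h.trace_two
    rw [Fintype.sum_prod_type] at h2
    exact h2
  have hA' : ∑ i, ∑ j, Γ (j, i) (j, i) = (N : ℂ) * ((N : ℂ) - 1) := by
    rw [Finset.sum_comm]; exact hA
  have hγ : ∑ i, γ i i = (N : ℂ) := h.trace_one
  rw [Fintype.sum_prod_type]
  simp_rw [Fintype.sum_prod_type, sum_t2Map_diag γ Γ]
  simp only [Finset.sum_add_distrib, Finset.sum_sub_distrib, Finset.sum_ite_eq, Finset.mem_univ,
    if_true, Finset.sum_const, Finset.card_univ, nsmul_eq_mul, hA, hA', hγ, ← Finset.mul_sum]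
  ring

/-- **`tr T2′ = tr T2 + Tr γ = N (r(r−1) − (r−2)(N−1)) + N`** on the DQG-feasible set: the `T2′`
block matrix is `(T2 X; X† γ)` ("we can summarize the four blocks in `T2′` matrix as follows"), so its
trace adds the 1-matrix trace `N` to `trace_t2Map`. The a-priori trace constant of the `T2′` block.
[cite: NakataEtAl2008, §II.B] -/
theorem IsDQGFeasible.trace_t2PrimeMap (h : IsDQGFeasible N γ Γ) :
    ∑ I : (ι × ι × ι) ⊕ ι, t2PrimeMap γ Γ I I =
      (N : ℂ) * ((Fintype.card ι : ℂ) * ((Fintype.card ι : ℂ) - 1) -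
        ((Fintype.card ι : ℂ) - 2) * ((N : ℂ) - 1)) + N := by
  rw [Fintype.sum_sum_type]
  simp only [t2PrimeMap, Matrix.fromBlocks_apply₁₁, Matrix.fromBlocks_apply₂₂]
  rw [h.trace_t2Map, h.trace_one]

/-- **`tr T1 = N(N−1)(N−2) + (r−N)(r−N−1)(r−N−2)`** on the DQG-feasible set (full index set `ι³`):
the a-priori trace constant of the `T1` block. On a state `T1 = ³D + ³Qᵀ` (`t1Map_rdm`) and the two
terms are the second-quantized normalisations of the 3-particle and the 3-hole matrix, "the
normalization is `N!/(p!(N−p)!)`" / "Normalization of the p-HRDM in second quantization is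
`(r−N)!/(p!(r−N−p)!)`" at `p = 3` (the tree's matrices carry no `1/p!`); here proved for every abstract
DQG-feasible pair from the trace row, the contraction row and antisymmetry alone (entry formula of
Nakata et al. (2008) §II.A). [cite: Mazziotti2007CSEChapter, §II.A eq. (8), p.168; §III.B eq. (18), p.172]
[cite: NakataEtAl2008, §II.A] -/
theorem IsDQGFeasible.trace_t1Map (h : IsDQGFeasible N γ Γ) :
    ∑ I : ι × ι × ι, t1Map γ Γ I I =
      (N : ℂ) * ((N : ℂ) - 1) * ((N : ℂ) - 2) +
        ((Fintype.card ι : ℂ) - N) * ((Fintype.card ι : ℂ) - N - 1) *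
          ((Fintype.card ι : ℂ) - N - 2) := by
  have hA : ∑ i, ∑ j, Γ (i, j) (i, j) = (N : ℂ) * ((N : ℂ) - 1) := by
    have h2 := h.trace_two
    rw [Fintype.sum_prod_type] at h2
    exact h2
  have hB : ∑ i, ∑ j, Γ (i, j) (j, i) = -((N : ℂ) * ((N : ℂ) - 1)) := by
    rw [← hA, ← Finset.sum_neg_distrib]
    refine Finset.sum_congr rfl fun i _ => ?_
    rw [← Finset.sum_neg_distrib]
    exact Finset.sum_congr rfl fun j _ => h.swap_snd (i, j) i j
  have hB' : ∑ i, ∑ j, Γ (j, i) (i, j) = -((N : ℂ) * ((N : ℂ) - 1)) := by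
    rw [Finset.sum_comm]; exact hB
  have hγ : ∑ i, γ i i = (N : ℂ) := h.trace_one
  rw [Fintype.sum_prod_type]
  simp_rw [Fintype.sum_prod_type, t1Map_apply]
  simp only [if_true, ite_mul, one_mul, zero_mul, mul_ite, mul_one, mul_zero,
    Finset.sum_add_distrib, Finset.sum_sub_distrib, Finset.sum_ite_irrel, Finset.sum_ite_eq,
    Finset.sum_ite_eq', Finset.mem_univ, Finset.sum_const_zero, Finset.sum_const, Finset.card_univ,
    nsmul_eq_mul, hA, hB, hB', hγ, ← Finset.mul_sum]
  ring

/-! ### The admissible trace bounds for member-list sub-blocks (real numbers) -/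

/-- Admissible a-priori trace bound for ANY member-list sub-block of the 2-RDM block `D = Γ` on the
DQG-feasible set: `Re tr Γ[f, f] ≤ N(N−1)` for injective `f` ("`n_d = N(N−1)`").
[cite: Mazziotti2007RDMChapter, §II.E.3, p.34] [cite: Jansson2007, §4 PBQ (ii), p.8] -/
theorem IsDQGFeasible.re_sum_diag_submatrix_two_le (h : IsDQGFeasible N γ Γ) {m : Type*} [Fintype m]
    {f : m → ι × ι} (hf : Function.Injective f) :
    ∑ i, (Γ (f i) (f i)).re ≤ (N : ℝ) * ((N : ℝ) - 1) := by
  refine (re_sum_diag_submatrix_le_of_posSemidef h.d_psd hf).trans (le_of_eq ?_)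
  rw [← Complex.re_sum, h.trace_two]
  simp

/-- Admissible a-priori trace bound for any member-list sub-block of the `Q` block on the DQG-feasible
set: `Re tr Q[f, f] ≤ (r−N)(r−N−1)` ("`n_q`"). [cite: Mazziotti2007RDMChapter, §II.E.3, p.34]
[cite: Jansson2007, §4 PBQ (ii), p.8] -/
theorem IsDQGFeasible.re_sum_diag_submatrix_qMap_le (h : IsDQGFeasible N γ Γ) {m : Type*} [Fintype m]
    {f : m → ι × ι} (hf : Function.Injective f) :
    ∑ i, (qMap γ Γ (f i) (f i)).re ≤
      ((Fintype.card ι : ℝ) - N) * ((Fintype.card ι : ℝ) - N - 1) := by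
  refine (re_sum_diag_submatrix_le_of_posSemidef h.q_psd hf).trans (le_of_eq ?_)
  rw [← Complex.re_sum, h.trace_qMap]
  simp

/-- Admissible a-priori trace bound for any member-list sub-block of the `G` block on the DQG-feasible
set: `Re tr G[f, f] ≤ N(r−N+1)` ("`n_g`"). [cite: Mazziotti2007RDMChapter, §II.E.3, p.34]
[cite: Jansson2007, §4 PBQ (ii), p.8] -/
theorem IsDQGFeasible.re_sum_diag_submatrix_gMap_le (h : IsDQGFeasible N γ Γ) {m : Type*} [Fintype m]
    {f : m → ι × ι} (hf : Function.Injective f) :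
    ∑ i, (gMap γ Γ (f i) (f i)).re ≤ (N : ℝ) * ((Fintype.card ι : ℝ) - N + 1) := by
  refine (re_sum_diag_submatrix_le_of_posSemidef h.g_psd hf).trans (le_of_eq ?_)
  rw [← Complex.re_sum, h.trace_gMap]
  simp

/-- Admissible a-priori trace bound for any member-list sub-block of the `T1` block on the
`PQGT1T2′`-feasible set: `Re tr T1[f, f] ≤ N(N−1)(N−2) + (r−N)(r−N−1)(r−N−2)`.
[cite: Jansson2007, §4 PBQ (ii), p.8] [cite: NakataEtAl2008, §II.A] -/
theorem IsDQGT1T2PrimeFeasible.re_sum_diag_submatrix_t1Map_le (h : IsDQGT1T2PrimeFeasible N γ Γ)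
    {m : Type*} [Fintype m] {f : m → ι × ι × ι} (hf : Function.Injective f) :
    ∑ i, (t1Map γ Γ (f i) (f i)).re ≤
      (N : ℝ) * ((N : ℝ) - 1) * ((N : ℝ) - 2) +
        ((Fintype.card ι : ℝ) - N) * ((Fintype.card ι : ℝ) - N - 1) *
          ((Fintype.card ι : ℝ) - N - 2) := by
  refine (re_sum_diag_submatrix_le_of_posSemidef h.t1_psd hf).trans (le_of_eq ?_)
  rw [← Complex.re_sum, h.toIsDQGFeasible.trace_t1Map]
  simp

/-- Admissible a-priori trace bound for any member-list sub-block of the `T2` block on the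
`PQGT1T2′`-feasible set (`T2 ⪰ 0` there as the principal block of `T2′`):
`Re tr T2[f, f] ≤ N (r(r−1) − (r−2)(N−1))`. [cite: Jansson2007, §4 PBQ (ii), p.8]
[cite: NakataEtAl2008, §II.A-C] -/
theorem IsDQGT1T2PrimeFeasible.re_sum_diag_submatrix_t2Map_le (h : IsDQGT1T2PrimeFeasible N γ Γ)
    {m : Type*} [Fintype m] {f : m → ι × ι × ι} (hf : Function.Injective f) :
    ∑ i, (t2Map γ Γ (f i) (f i)).re ≤
      (N : ℝ) * ((Fintype.card ι : ℝ) * ((Fintype.card ι : ℝ) - 1) -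
        ((Fintype.card ι : ℝ) - 2) * ((N : ℝ) - 1)) := by
  refine (re_sum_diag_submatrix_le_of_posSemidef h.t2Map_posSemidef hf).trans (le_of_eq ?_)
  rw [← Complex.re_sum, h.toIsDQGFeasible.trace_t2Map]
  simp

/-- Admissible a-priori trace bound for any member-list sub-block of the `T2′` block on the
`PQGT1T2′`-feasible set: `Re tr T2′[f, f] ≤ N (r(r−1) − (r−2)(N−1)) + N` — the constant a certified end
charges against the eigenvalue deficit `|min(0, d)|` of the `T2′` dual slack.
[cite: Jansson2007, §4 PBQ (ii), p.8; §7 Cor. 7.1 (a), p.14] [cite: NakataEtAl2008, §II.B] -/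
theorem IsDQGT1T2PrimeFeasible.re_sum_diag_submatrix_t2PrimeMap_le (h : IsDQGT1T2PrimeFeasible N γ Γ)
    {m : Type*} [Fintype m] {f : m → (ι × ι × ι) ⊕ ι} (hf : Function.Injective f) :
    ∑ i, (t2PrimeMap γ Γ (f i) (f i)).re ≤
      (N : ℝ) * ((Fintype.card ι : ℝ) * ((Fintype.card ι : ℝ) - 1) -
        ((Fintype.card ι : ℝ) - 2) * ((N : ℝ) - 1)) + N := by
  refine (re_sum_diag_submatrix_le_of_posSemidef h.t2Prime_psd hf).trans (le_of_eq ?_)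
  rw [← Complex.re_sum, h.toIsDQGFeasible.trace_t2PrimeMap]
  simp

end Abstract

end Literature.MathematicalPhysics.QuantumChemistry

end
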